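import Literature.Computability.Cryptography.RegevSamplerMachineWord
import Literature.Computability.Cryptography.RegevSamplerBlockPar
import Literature.Computability.Complexity.SparseSetsUpwardSeparationTally
import Literature.Computability.QuantumComplexity.CoreDescLayoutFP
import Literature.Computability.QuantumComplexity.AbstractGateUniform
import Literature.Computability.QuantumComplexity.RevWidthUnaryFP
import HarnessLib

/-!
# The inner circuit family of the iterative step's sampler: one machine circuit per input length

Topic `Computability/Cryptography` (family `pqc`), grouping namespace `Regev2009.SamplerRegs`; the uniformity half of
[Regev2009, Lemma 3.14 (proof)]. The quantum sampler is ONE uniform circuit family; in the classical-wrapper form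
(`CWrap.family`) its inner family is indexed by the input length alone, so ALL instance-dependent sizes are written
into the LENGTH of the pre-processed input [AroraBarak2009, §6.2 and proof of Thm. 6.15: padding]:

* `Sz` — the size record `(n, e, T, m, L, Lq, np, p₀)` of the machine circuit; `Sz.code`, `lenCode s wpad = ⟪code s, wpad⟫`
  (Cantor pairing; `wpad ≤ lenCode s wpad` lets the pre-processor make the register as wide as needed), `szOf N` —
  the record decoded from a length (`szOf_lenCode`);
* `Sz.sL, sY, sR, sB` (the register schedule), `Sz.base`, `Sz.pp, UU, kq` — the derived sizes; `Sz.lay s W hW` — the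
  schedule layout;
* `Guard Rf s N` — the thirteen inequalities under which the machine circuit with sizes `s` is well formed on `N`
  wires (layout well-formedness, the three block tops, Fourier / oracle / Grover–Rudolph room, the parameter-word
  length for the null table datum, the source offset), all DECIDED ON CODES (`guard_codeFP`);
* `innerFamily Rf` — **the inner family**: on `N` wires, if `Guard Rf (szOf N) N` then the data-free machine circuit
  `machineCircPar` on the standard objects with the null table datum, else the empty circuit; no ancillas;
* `innerFamily_isOracleFree`, `circ_innerFamily_of_guard`, `map_toAG_circ_innerFamily` and
  **`innerFamily_isUniform`** — polynomial-time uniformity by `QCircuitFamily.isUniform_of_abstract₀` from the machine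
  word on codes (`machineAN_codeFP_of`).

Everything is proved; no named fact is introduced.

## References

* O. Regev, *On lattices, learning with errors, random linear codes, and cryptography*, J. ACM 56(6) (2009), Lemma 3.14
  (proof) [Regev2009].
* S. Arora, B. Barak, *Computational Complexity: A Modern Approach*, CUP 2009, §6.2 and proof of Thm. 6.15
  [AroraBarak2009].
-/

noncomputable section

namespace Literature.Computability.Cryptography.Regev2009.SamplerRegs

open _root_.Computability Literature.Algebra.EuclideanLattices Literature.Algebra.EuclideanLattices.Regev2009
  Literature.Computability.QuantumComplexity Literature.Computability.QuantumComplexity.AJLCore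
  Literature.Computability.QuantumComplexity.CleanPlaced Literature.Computability.Complexity
  Literature.Computability.Complexity.CodeFP SamplerClassical SamplerClassical.Layout SamplerSubst

/-! ### The size record and its length code -/

/-- **The size record of the machine circuit**: dimension `n`, instance-code bound `e`, width exponent `T`, precision
`m`, input-zone length `L`, query-prefix length `Lq`, parameter-word length `np`, source offset `p₀`.
[cite: Regev2009, Lemma 3.14 (proof: "2^{poly(n)}-bounded quantities")] -/
structure Sz where
  /-- dimension -/
  n : ℕ
  /-- bound on the instance code length -/
  e : ℕ
  /-- width exponent -/
  T : ℕ
  /-- precision -/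
  m : ℕ
  /-- input-zone length -/
  L : ℕ
  /-- query-prefix length -/
  Lq : ℕ
  /-- parameter-word length -/
  np : ℕ
  /-- source offset of the parameter word in the input zone -/
  p₀ : ℕ

namespace Sz

variable (s : Sz)

/-- Cell register length. [cite: Regev2009, Lemma 3.14 (proof)] -/
def sL : ℕ := schedL s.n s.e s.T s.m
/-- Branch register length. [cite: Regev2009, Lemma 3.14 (proof)] -/
def sY : ℕ := schedY s.n s.e
/-- Residue register length. [cite: Regev2009, Lemma 3.14 (proof)] -/
def sR : ℕ := schedR s.n s.e s.T s.m
/-- Answer width. [cite: Regev2009, Lemma 3.14 (proof)] -/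
def sB : ℕ := schedB s.n s.e s.T
/-- Base of the work window. [folklore] -/
def base : ℕ := stdBase s.n s.sL s.sY s.sR s.sB s.L
/-- Grover–Rudolph evaluator precision `p = 4(2m+ℓ+3)`. [cite: Regev2009, Lemma 3.12 (proof)] -/
def pp : ℕ := 4 * (2 * s.m + s.sL + 3)
/-- Clamp budget `U = 6(p+ℓ+3)`. [cite: Regev2009, Lemma 3.12 (proof)] -/
def UU : ℕ := 6 * (4 * (2 * s.m + s.sL + 3) + s.sL + 3)
/-- Query width `Lq + n ℓ_R`. [folklore] -/
def kq : ℕ := s.Lq + s.n * s.sR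
/-- The schedule layout of the record on `W` wires. [cite: Regev2009, Lemma 3.14 (proof)] -/
def lay (W : ℕ) (hW : 0 < W) : Layout W s.n := schedLayout s.n s.e s.T s.m s.L s.Lq W hW

/-- The Cantor code of the record. [folklore] -/
def code : ℕ :=
  Nat.pair s.n (Nat.pair s.e (Nat.pair s.T (Nat.pair s.m (Nat.pair s.L (Nat.pair s.Lq (Nat.pair s.np s.p₀))))))

/-- Decoding a record. [folklore] -/
def ofCode (c : ℕ) : Sz :=
  ⟨c.unpair.1, c.unpair.2.unpair.1, c.unpair.2.unpair.2.unpair.1, c.unpair.2.unpair.2.unpair.2.unpair.1,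
    c.unpair.2.unpair.2.unpair.2.unpair.2.unpair.1, c.unpair.2.unpair.2.unpair.2.unpair.2.unpair.2.unpair.1,
    c.unpair.2.unpair.2.unpair.2.unpair.2.unpair.2.unpair.2.unpair.1,
    c.unpair.2.unpair.2.unpair.2.unpair.2.unpair.2.unpair.2.unpair.2⟩

/-- Decoding inverts coding. [cite: AroraBarak2009, §1.2 (representing pairs and tuples)] -/
@[simp] theorem ofCode_code : ofCode s.code = s := by
  cases s; simp [ofCode, code, Nat.unpair_pair]

end Sz

/-- **The length code**: the record and a free padding amount `wpad`, paired. [cite: AroraBarak2009, §6.2 (padding)] -/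
def lenCode (s : Sz) (wpad : ℕ) : ℕ := Nat.pair s.code wpad

/-- The record read off a length. [folklore] -/
def szOf (N : ℕ) : Sz := Sz.ofCode N.unpair.1

/-- The length code decodes to its record. [cite: AroraBarak2009, §6.2 and proof of Thm. 6.15 (padding)] -/
@[simp] theorem szOf_lenCode (s : Sz) (wpad : ℕ) : szOf (lenCode s wpad) = s := by
  simp [szOf, lenCode, Nat.unpair_pair]

/-- The length code dominates the padding amount. [cite: AroraBarak2009, §6.2 and proof of Thm. 6.15 (padding)] -/
theorem le_lenCode (s : Sz) (wpad : ℕ) : wpad ≤ lenCode s wpad := Nat.right_le_pair _ _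

/-! ### Decoding the length on codes -/

section Decode

/-- Binary to unary for a quantity bounded by the (unary) input. [folklore] -/
private theorem unOfNat_le {f : ℕ → ℕ} (hf : CodeFP unE natE f) (hle : ∀ N, f N ≤ N) : CodeFP unE unE f :=
  (unOfNatMin.comp ((CodeFP.id unE).pair hf)).congr fun N => min_eq_left (hle N)

/-- The first component of the length in binary. [folklore] -/
private theorem unpair1_codeFP : CodeFP unE natE (fun N => N.unpair.1) := (SparseTally.natUnpairC.comp natOfUn).fst'

/-- The decoded record's fields in binary. [folklore] -/
private theorem szOf_fields_codeFP :
    CodeFP unE natE (fun N => (szOf N).n) ∧ CodeFP unE natE (fun N => (szOf N).e) ∧ CodeFP unE natE (fun N => (szOf N).T) ∧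
      CodeFP unE natE (fun N => (szOf N).m) ∧ CodeFP unE natE (fun N => (szOf N).L) ∧ CodeFP unE natE (fun N => (szOf N).Lq) ∧
      CodeFP unE natE (fun N => (szOf N).np) ∧ CodeFP unE natE (fun N => (szOf N).p₀) := by
  have h1 : CodeFP unE (pairE natE natE) (fun N => N.unpair.1.unpair) := SparseTally.natUnpairC.comp unpair1_codeFP
  have h2 : CodeFP unE (pairE natE natE) (fun N => N.unpair.1.unpair.2.unpair) := SparseTally.natUnpairC.comp h1.snd'
  have h3 : CodeFP unE (pairE natE natE) (fun N => N.unpair.1.unpair.2.unpair.2.unpair) := SparseTally.natUnpairC.comp h2.snd'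
  have h4 : CodeFP unE (pairE natE natE) (fun N => N.unpair.1.unpair.2.unpair.2.unpair.2.unpair) :=
    SparseTally.natUnpairC.comp h3.snd'
  have h5 : CodeFP unE (pairE natE natE) (fun N => N.unpair.1.unpair.2.unpair.2.unpair.2.unpair.2.unpair) :=
    SparseTally.natUnpairC.comp h4.snd'
  have h6 : CodeFP unE (pairE natE natE) (fun N => N.unpair.1.unpair.2.unpair.2.unpair.2.unpair.2.unpair.2.unpair) :=
    SparseTally.natUnpairC.comp h5.snd'
  have h7 : CodeFP unE (pairE natE natE) (fun N => N.unpair.1.unpair.2.unpair.2.unpair.2.unpair.2.unpair.2.unpair.2.unpair) :=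
    SparseTally.natUnpairC.comp h6.snd'
  refine ⟨h1.fst'.congr fun N => ?_, h2.fst'.congr fun N => ?_, h3.fst'.congr fun N => ?_, h4.fst'.congr fun N => ?_,
    h5.fst'.congr fun N => ?_, h6.fst'.congr fun N => ?_, h7.fst'.congr fun N => ?_, h7.snd'.congr fun N => ?_⟩ <;>
    simp only [szOf, Sz.ofCode]

/-- The decoded record's fields are at most the length. [folklore] -/
private theorem szOf_fields_le (N : ℕ) :
    (szOf N).n ≤ N ∧ (szOf N).e ≤ N ∧ (szOf N).T ≤ N ∧ (szOf N).m ≤ N ∧ (szOf N).L ≤ N ∧ (szOf N).Lq ≤ N ∧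
      (szOf N).np ≤ N ∧ (szOf N).p₀ ≤ N := by
  have hc : N.unpair.1 ≤ N := Nat.unpair_left_le N
  have hl : ∀ c : ℕ, c.unpair.1 ≤ c := Nat.unpair_left_le
  have hr : ∀ c : ℕ, c.unpair.2 ≤ c := Nat.unpair_right_le
  simp only [szOf, Sz.ofCode]
  refine ⟨(hl _).trans hc, ?_, ?_, ?_, ?_, ?_, ?_, ?_⟩
  · exact (hl _).trans ((hr _).trans hc)
  · exact (hl _).trans ((hr _).trans ((hr _).trans hc))
  · exact (hl _).trans ((hr _).trans ((hr _).trans ((hr _).trans hc)))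
  · exact (hl _).trans ((hr _).trans ((hr _).trans ((hr _).trans ((hr _).trans hc))))
  · exact (hl _).trans ((hr _).trans ((hr _).trans ((hr _).trans ((hr _).trans ((hr _).trans hc)))))
  · exact (hl _).trans ((hr _).trans ((hr _).trans ((hr _).trans ((hr _).trans ((hr _).trans ((hr _).trans hc))))))
  · exact (hr _).trans ((hr _).trans ((hr _).trans ((hr _).trans ((hr _).trans ((hr _).trans ((hr _).trans hc))))))

attribute [irreducible] szOf

end Decode

/-! ### The guard -/

/-- **The guard**: the machine circuit with sizes `s` and solver `Rf` is well formed on `N` wires.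
[cite: Regev2009, Lemma 3.14 (proof)] -/
abbrev Guard (Rf : UniformQCircuitFamily) (s : Sz) (N : ℕ) : Prop :=
  0 < N ∧ s.Lq ≤ s.L ∧ s.n * s.sL ≤ s.L ∧ s.n * s.sY ≤ s.L ∧ s.n * s.sR ≤ s.L ∧
    topY s.n s.sL s.sY s.sR s.sB s.L s.Lq ≤ N ∧ topS s.n s.sL s.sY s.sR s.sB s.L s.Lq ≤ N ∧
    topX s.n s.sL s.sY s.sR s.sB s.L s.Lq ≤ N ∧
    s.base + s.n * QFTKit.qbsize s.sR (2 * s.m + 4) ≤ N ∧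
    s.base + (s.kq + Rf.family.ancillas s.kq) ≤ N ∧
    (GRCosineMach.pcode (((0 : ℚ), (s.pp, s.UU)), (2 * s.m + 1, s.sL))).length ≤ s.np ∧
    s.p₀ + s.np ≤ s.L ∧
    s.base + s.n * GRData.B s.sL s.np (GRTableMach.wlen LevelCode.clamp s.sL s.np) (2 * s.m + 1 + 1) ≤ N

/-! ### The inner family -/

/-- **The machine circuit of a guarded size record on `N` wires**: `machineCircPar` on the canonical instance `⟨n, 1⟩`,
the schedule layout, the standard zone / embedding / sources, the clamped level table with the null datum, Fourier
precision `2m+4`. [cite: Regev2009, Lemma 3.14 (proof)] -/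
def guardedCirc (Rf : UniformQCircuitFamily) (s : Sz) (N : ℕ) (h : Guard Rf s N) : QCircuit cliffordT N :=
  machineCircPar (⟨s.n, 1⟩ : LatticeInstance) (Λ := s.lay N h.1)
    (schedLayout_OK h.1 h.2.1 h.2.2.1 h.2.2.2.1 h.2.2.2.2.1 h.2.2.2.2.2.2.2.2.1)
    (schedLayout_fits h.1 h.2.2.2.2.2.1 h.2.2.2.2.2.2.1 h.2.2.2.2.2.2.2.1) Rf
    (stdZone (s.lay N h.1) (schedLayout_OK h.1 h.2.1 h.2.2.1 h.2.2.2.1 h.2.2.2.2.1 h.2.2.2.2.2.2.2.2.1)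
      h.2.2.2.2.2.2.2.2.2.1)
    (GRTableMach.data LevelCode.clamp 0 s.pp s.UU (2 * s.m + 1) s.sL s.np h.2.2.2.2.2.2.2.2.2.2.1)
    (stdEmb (⟨s.n, 1⟩ : LatticeInstance)
      (schedLayout_OK h.1 h.2.1 h.2.2.1 h.2.2.2.1 h.2.2.2.2.1 h.2.2.2.2.2.2.2.2.1) h.2.2.2.2.2.2.2.2.2.2.2.2)
    (srcU (⟨s.n, 1⟩ : LatticeInstance) (s.lay N h.1) s.p₀) (2 * s.m + 4) (by omega) h.2.2.2.2.2.2.2.2.1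

open Classical in
/-- **The inner family**: per input length, the guarded machine circuit of the decoded size record, else the empty
circuit; no ancillas. [cite: Regev2009, Lemma 3.14 (proof)] [cite: AroraBarak2009, §6.2 and proof of Thm. 6.15] -/
def innerFamily (Rf : UniformQCircuitFamily) : QCircuitFamily cliffordT where
  ancillas := fun _ => 0
  circ := fun N => if h : Guard Rf (szOf N) N then guardedCirc Rf (szOf N) N h else ⟨[]⟩

/-- The inner family has no ancillas. [cite: Regev2009, Lemma 3.14 (proof)] -/
theorem innerFamily_ancillas (Rf : UniformQCircuitFamily) (N : ℕ) : (innerFamily Rf).ancillas N = 0 := rfl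

open Classical in
/-- On a guarded length the inner family's circuit is the machine circuit. [cite: Regev2009, Lemma 3.14 (proof)] -/
theorem circ_innerFamily_of_guard (Rf : UniformQCircuitFamily) {N : ℕ} (h : Guard Rf (szOf N) N) :
    (innerFamily Rf).circ N = guardedCirc Rf (szOf N) N h := dif_pos h

open Classical in
/-- Off the guard the inner family's circuit is empty. [cite: Regev2009, Lemma 3.14 (proof)] -/
theorem circ_innerFamily_of_not_guard (Rf : UniformQCircuitFamily) {N : ℕ} (h : ¬ Guard Rf (szOf N) N) :
    (innerFamily Rf).circ N = ⟨[]⟩ := dif_neg h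

/-- **The inner family is oracle-free.** [cite: Regev2009, Lemma 3.14 (proof)] -/
theorem innerFamily_isOracleFree (Rf : UniformQCircuitFamily) : (innerFamily Rf).IsOracleFree := by
  intro N
  by_cases h : Guard Rf (szOf N) N
  · rw [circ_innerFamily_of_guard Rf h]
    exact isOracleFree_machineCircPar _ _ _ Rf _ _ _ _ _ _ _
  · rw [circ_innerFamily_of_not_guard Rf h]
    intro g hg
    simp at hg

/-! ### The abstract word of the inner family -/

/-- The machine word does not depend on the register width. [folklore] -/
private theorem machineAN_lay_eq (s : Sz) {W W' : ℕ} (hW : 0 < W) (hW' : 0 < W') (τ : LevelCode) (Rf : UniformQCircuitFamily)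
    (np kk p₀ kF : ℕ) : machineAN (s.lay W hW) τ Rf np kk p₀ kF = machineAN (s.lay W' hW') τ Rf np kk p₀ kF := rfl

open Classical in
/-- The abstract gate list of the inner family: the machine word of the decoded record under the guard, else `[]`.
[cite: AroraBarak2009, §6.2 and proof of Thm. 6.15] -/
def innerA (Rf : UniformQCircuitFamily) (N : ℕ) : List AG :=
  if Guard Rf (szOf N) N then
    machineAN ((szOf N).lay 1 Nat.one_pos) LevelCode.clamp Rf (szOf N).np (2 * (szOf N).m + 1 + 1) (szOf N).p₀
      (2 * (szOf N).m + 4)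
  else []

open Classical in
/-- **The inner family abstracts to `innerA`.** [cite: Regev2009, Lemma 3.14 (proof)] [cite: AroraBarak2009, §6.2 and proof of Thm. 6.15] -/
theorem map_toAG_circ_innerFamily (Rf : UniformQCircuitFamily) (N : ℕ) :
    ((innerFamily Rf).circ N).gates.map toAG = innerA Rf N := by
  unfold innerA
  by_cases h : Guard Rf (szOf N) N
  · rw [circ_innerFamily_of_guard Rf h, if_pos h]
    exact (map_toAG_machineCircPar_eq_machineAN (⟨(szOf N).n, 1⟩ : LatticeInstance)
      (schedLayout_OK h.1 h.2.1 h.2.2.1 h.2.2.2.1 h.2.2.2.2.1 h.2.2.2.2.2.2.2.2.1)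
      (schedLayout_fits h.1 h.2.2.2.2.2.1 h.2.2.2.2.2.2.1 h.2.2.2.2.2.2.2.1) Rf h.2.2.2.2.2.2.2.2.2.1
      LevelCode.clamp 0 (szOf N).pp (szOf N).UU (2 * (szOf N).m + 1) (szOf N).np h.2.2.2.2.2.2.2.2.2.2.1
      h.2.2.2.2.2.2.2.2.2.2.2.2 h.2.2.2.2.2.2.2.2.2.2.2.1 (2 * (szOf N).m + 4) (by omega) h.2.2.2.2.2.2.2.2.1
      (fun _ => rfl)).trans (machineAN_lay_eq (szOf N) h.1 Nat.one_pos LevelCode.clamp Rf _ _ _ _)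
  · rw [circ_innerFamily_of_not_guard Rf h, if_neg h]
    rfl

/-! ### The sizes on codes -/

section Codes


/-- **The unary size context**: the record's fields and the schedule in unary on codes of the length.
[cite: AroraBarak2009, §6.2 (proof of Thm. 6.15)] -/
structure SzCodes : Prop where
  n : CodeFP unE unE (fun N => (szOf N).n)
  e : CodeFP unE unE (fun N => (szOf N).e)
  T : CodeFP unE unE (fun N => (szOf N).T)
  m : CodeFP unE unE (fun N => (szOf N).m)
  L : CodeFP unE unE (fun N => (szOf N).L)
  Lq : CodeFP unE unE (fun N => (szOf N).Lq)
  np : CodeFP unE unE (fun N => (szOf N).np)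
  p₀ : CodeFP unE unE (fun N => (szOf N).p₀)
  sL : CodeFP unE unE (fun N => (szOf N).sL)
  sY : CodeFP unE unE (fun N => (szOf N).sY)
  sR : CodeFP unE unE (fun N => (szOf N).sR)
  sB : CodeFP unE unE (fun N => (szOf N).sB)
  base : CodeFP unE natE (fun N => (szOf N).base)
  kk : CodeFP unE unE (fun N => 2 * (szOf N).m + 1 + 1)
  kF : CodeFP unE unE (fun N => 2 * (szOf N).m + 4)
  pp : CodeFP unE unE (fun N => (szOf N).pp)
  UU : CodeFP unE unE (fun N => (szOf N).UU)
  kq : CodeFP unE unE (fun N => (szOf N).kq)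

/-- The size context exists (all sizes are polynomials in quantities at most the length). [cite: AroraBarak2009, §6.2 (proof of Thm. 6.15)] -/
theorem szCodes : SzCodes := by
  obtain ⟨bn, be, bT, bm, bL, bLq, bnp, bp₀⟩ := szOf_fields_codeFP
  have hn : CodeFP unE unE (fun N => (szOf N).n) := unOfNat_le bn fun N => (szOf_fields_le N).1
  have he : CodeFP unE unE (fun N => (szOf N).e) := unOfNat_le be fun N => (szOf_fields_le N).2.1
  have hT : CodeFP unE unE (fun N => (szOf N).T) := unOfNat_le bT fun N => (szOf_fields_le N).2.2.1
  have hm : CodeFP unE unE (fun N => (szOf N).m) := unOfNat_le bm fun N => (szOf_fields_le N).2.2.2.1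
  have hL : CodeFP unE unE (fun N => (szOf N).L) := unOfNat_le bL fun N => (szOf_fields_le N).2.2.2.2.1
  have hLq : CodeFP unE unE (fun N => (szOf N).Lq) := unOfNat_le bLq fun N => (szOf_fields_le N).2.2.2.2.2.1
  have hnp : CodeFP unE unE (fun N => (szOf N).np) := unOfNat_le bnp fun N => (szOf_fields_le N).2.2.2.2.2.2.1
  have hp₀ : CodeFP unE unE (fun N => (szOf N).p₀) := unOfNat_le bp₀ fun N => (szOf_fields_le N).2.2.2.2.2.2.2
  have c := fun k : ℕ => BP.uconst unE k
  have h2ne : CodeFP unE unE (fun N => 2 * (szOf N).n * (szOf N).e) := BP.umul (BP.umul (c 2) hn) he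
  have he2 : CodeFP unE unE (fun N => (szOf N).e * (2 * (szOf N).e + 2)) := BP.umul he (BP.uadd (BP.umul (c 2) he) (c 2))
  have hsR : CodeFP unE unE (fun N => (szOf N).sR) :=
    (BP.uadd (BP.uadd (BP.uadd (BP.uadd (BP.uadd he2 h2ne) (BP.umul (c 3) hT)) (BP.umul (c 3) he)) hm) (c 8) :)
  have hsL : CodeFP unE unE (fun N => (szOf N).sL) := (BP.uadd (BP.uadd (BP.uadd (BP.uadd hsR h2ne) hT) he) (c 1) :)
  have hsY : CodeFP unE unE (fun N => (szOf N).sY) := (BP.uadd (BP.uadd h2ne he2) (c 2) :)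
  have hsB : CodeFP unE unE (fun N => (szOf N).sB) := (BP.uadd (BP.uadd (BP.uadd h2ne hT) (BP.umul (c 4) he)) (c 4) :)
  have hbase : CodeFP unE natE (fun N => (szOf N).base) :=
    BP.toNat (BP.uadd (BP.uadd (BP.uadd (BP.uadd (BP.umul hn hsL) hL) (BP.umul hn hsY)) (BP.umul hn hsR)) (BP.umul hn hsB) :)
  have hkk : CodeFP unE unE (fun N => 2 * (szOf N).m + 1 + 1) := BP.uadd (BP.uadd (BP.umul (c 2) hm) (c 1)) (c 1)
  have hkF : CodeFP unE unE (fun N => 2 * (szOf N).m + 4) := BP.uadd (BP.umul (c 2) hm) (c 4)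
  have hpp : CodeFP unE unE (fun N => (szOf N).pp) := (BP.umul (c 4) (BP.uadd (BP.uadd (BP.umul (c 2) hm) hsL) (c 3)) :)
  have hUU : CodeFP unE unE (fun N => (szOf N).UU) :=
    (BP.umul (c 6) (BP.uadd (BP.uadd (BP.umul (c 4) (BP.uadd (BP.uadd (BP.umul (c 2) hm) hsL) (c 3))) hsL) (c 3)) :)
  have hkq : CodeFP unE unE (fun N => (szOf N).kq) := (BP.uadd hLq (BP.umul hn hsR) :)
  exact ⟨hn, he, hT, hm, hL, hLq, hnp, hp₀, hsL, hsY, hsR, hsB, hbase, hkk, hkF, hpp, hUU, hkq⟩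

/-- Conjunction of decided propositions on codes. [folklore] -/
private theorem andProp {α : Type} {eα : α → List Bool} {P Q : α → Prop} [DecidablePred P] [DecidablePred Q]
    (hp : CodeFP eα bitE (fun a => decide (P a))) (hq : CodeFP eα bitE (fun a => decide (Q a))) :
    CodeFP eα bitE (fun a => decide (P a ∧ Q a)) :=
  (hp.and hq).congr fun a => (Bool.decide_and (P a) (Q a)).symm

/-- A decided `≤` between two quantities given in binary on codes. [folklore] -/
private theorem leProp {α : Type} {eα : α → List Bool} {x y : α → ℕ} (hx : CodeFP eα natE x) (hy : CodeFP eα natE y) :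
    CodeFP eα bitE (fun a => decide (x a ≤ y a)) :=
  (natLe.comp (hx.pair hy) :)

/-- The top of a clean block's work window in binary on codes, from the data length in unary and the base in binary.
[cite: AroraBarak2009, §6.2 (proof of Thm. 6.15)] -/
theorem top_codeFP_of {α : Type} {eα : α → List Bool} (e : ℕ) (M : Turing.TM2ComputableAux Bool Bool)
    {n₀ base : α → ℕ} {v : α → List Bool} (hn₀ : CodeFP eα unE n₀) (hN : CodeFP eα unE (fun a => n₀ a + (v a).length))
    (hbase : CodeFP eα natE base) : CodeFP eα natE (fun a => CleanPlaced.top e M (n₀ a) (v a) (base a)) :=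
  (natAdd.comp (hbase.pair (natSub.comp ((BP.toNat (RevClean.width_unary_of (e := e) (M := M) hN)).pair (BP.toNat hn₀)))) :)

/-- The length of the null-datum parameter code in unary on codes. [cite: AroraBarak2009, §1.3, §6.2 (proof of Thm. 6.15)] -/
theorem pcodeLen_codeFP (C : SzCodes) :
    CodeFP unE unE (fun N => (GRCosineMach.pcode (((0 : ℚ), ((szOf N).pp, (szOf N).UU)), (2 * (szOf N).m + 1, (szOf N).sL))).length) := by
  have hP : CodeFP unE GRCosineCodeFP.parE
      (fun N => (((0 : ℚ), ((szOf N).pp, (szOf N).UU)), (2 * (szOf N).m + 1, (szOf N).sL))) :=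
    ((const unE (0 : ℚ)).pair (C.pp.pair C.UU)).pair ((BP.uadd (BP.umul (BP.uconst unE 2) C.m) (BP.uconst unE 1)).pair C.sL)
  have hs : CodeFP unE strE (fun N => GRCosineCodeFP.parE (((0 : ℚ), ((szOf N).pp, (szOf N).UU)), (2 * (szOf N).m + 1, (szOf N).sL))) :=
    hP.recodeOut fun _ => rfl
  have hl : CodeFP unE unE (fun N =>
      (GRCosineCodeFP.parE (((0 : ℚ), ((szOf N).pp, (szOf N).UU)), (2 * (szOf N).m + 1, (szOf N).sL))).length) :=
    strLength.comp hs
  exact (BP.uadd (BP.uadd (BP.umul (BP.uconst unE 2) hl) (BP.uconst unE 1)) (BP.uconst unE 1)).congr fun N => by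
    rw [GRCosineMach.pcode, length_boolPair, List.length_nil]

/-- **The guard is decided in polynomial time on codes of the length.** [cite: AroraBarak2009, §6.2 and proof of Thm. 6.15] -/
theorem guard_codeFP (Rf : UniformQCircuitFamily) : CodeFP unE bitE (fun N => decide (Guard Rf (szOf N) N)) := by
  have C := szCodes
  have hN : CodeFP unE natE (fun N => N) := natOfUn
  have hd : CodeFP unE unE (fun N => (szOf N).n * (szOf N).sL + (szOf N).L) := BP.uadd (BP.umul C.n C.sL) C.L
  have hreg : CodeFP unE unE (fun N => (szOf N).n * (szOf N).sY + (szOf N).n * (szOf N).sR + (szOf N).n * (szOf N).sB + (szOf N).L) :=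
    BP.uadd (BP.uadd (BP.uadd (BP.umul C.n C.sY) (BP.umul C.n C.sR)) (BP.umul C.n C.sB)) C.L
  -- the layout at width 1 as a context (only its numeric fields are read)
  have hvY := vY_codeFP_of (σ := ℕ) (fun N => (szOf N).lay 1 Nat.one_pos) C.n C.sL C.sY C.Lq hd
  have hvS := vS_codeFP_of (σ := ℕ) (fun N => (szOf N).lay 1 Nat.one_pos) C.n C.sL C.sR C.Lq hd
  have hvX := vX_codeFP_of (σ := ℕ) (fun N => (szOf N).lay 1 Nat.one_pos) C.n C.sL C.sY C.sR C.sB C.Lq hreg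
  have hY : CodeFP unE natE (fun N => topY (szOf N).n (szOf N).sL (szOf N).sY (szOf N).sR (szOf N).sB (szOf N).L (szOf N).Lq) :=
    (top_codeFP_of eY MY hd (dataLen_codeFP_of hd hvY) C.base :)
  have hS : CodeFP unE natE (fun N => topS (szOf N).n (szOf N).sL (szOf N).sY (szOf N).sR (szOf N).sB (szOf N).L (szOf N).Lq) :=
    (top_codeFP_of eS MS hd (dataLen_codeFP_of hd hvS) C.base :)
  have hX : CodeFP unE natE (fun N => topX (szOf N).n (szOf N).sL (szOf N).sY (szOf N).sR (szOf N).sB (szOf N).L (szOf N).Lq) :=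
    (top_codeFP_of eX MX hreg (dataLen_codeFP_of hreg hvX) C.base :)
  have hq : CodeFP unE unE (fun N => QFTKit.qbsize (szOf N).sR (2 * (szOf N).m + 4)) := QFTKit.qbsize_unary.comp (C.sR.pair C.kF)
  have hanc : CodeFP unE natE (fun N => Rf.family.ancillas (szOf N).kq) := solverAnc_codeFP_of Rf C.kq
  have hB : CodeFP unE unE (fun N => GRData.B (szOf N).sL (szOf N).np (GRTableMach.wlen LevelCode.clamp (szOf N).sL (szOf N).np)
      (2 * (szOf N).m + 1 + 1)) := grB_codeFP_of LevelCode.clamp C.sL C.np C.kk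
  have hpc := pcodeLen_codeFP C
  refine andProp (P := fun N => 0 < N) ((natLt.comp ((const unE 0).pair hN) :)) (andProp (leProp (BP.toNat C.Lq) (BP.toNat C.L))
    (andProp (leProp (BP.toNat (BP.umul C.n C.sL)) (BP.toNat C.L)) (andProp (leProp (BP.toNat (BP.umul C.n C.sY)) (BP.toNat C.L))
    (andProp (leProp (BP.toNat (BP.umul C.n C.sR)) (BP.toNat C.L)) (andProp (leProp hY hN) (andProp (leProp hS hN)
    (andProp (leProp hX hN) (andProp (leProp (natAdd.comp (C.base.pair (BP.toNat (BP.umul C.n hq))) :) hN)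
    (andProp (leProp (natAdd.comp (C.base.pair (natAdd.comp ((BP.toNat C.kq).pair hanc))) :) hN)
    (andProp (leProp (BP.toNat hpc) (BP.toNat C.np)) (andProp (leProp (BP.toNat (BP.uadd C.p₀ C.np)) (BP.toNat C.L))
    (leProp (natAdd.comp (C.base.pair (BP.toNat (BP.umul C.n hB))) :) hN))))))))))))

/-- **The abstract word of the inner family is computed in polynomial time on codes of the length.**
[cite: Regev2009, Lemma 3.14 (proof)] [cite: AroraBarak2009, §6.2 and proof of Thm. 6.15] -/
theorem innerA_codeFP (Rf : UniformQCircuitFamily) : CodeFP unE (rawE agE0) (innerA Rf) := by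
  have C := szCodes
  have hM := machineAN_codeFP_of (σ := ℕ) (fun N => (szOf N).lay 1 Nat.one_pos) LevelCode.clamp Rf (fun _ _ => rfl)
    C.n C.sL C.sY C.sR C.sB C.L C.Lq C.base C.np C.kk C.p₀ C.kF
  exact iteProp (P := fun N => Guard Rf (szOf N) N) (guard_codeFP Rf) hM (const unE ([] : List AG))

end Codes

/-- **The inner family is polynomial-time uniform.** [cite: Regev2009, Lemma 3.14 (proof)]
[cite: AroraBarak2009, §6.2 and proof of Thm. 6.15] -/
theorem innerFamily_isUniform (Rf : UniformQCircuitFamily) : (innerFamily Rf).IsUniform :=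
  QCircuitFamily.isUniform_of_abstract₀ (innerFamily Rf) (innerFamily_isOracleFree Rf) (innerFamily_ancillas Rf)
    (innerA Rf) (map_toAG_circ_innerFamily Rf) (innerA_codeFP Rf)

end Literature.Computability.Cryptography.Regev2009.SamplerRegs

end
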